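import Summits.QuantumFields.BalabanUV.Beta.GAN24.StaircaseFaces

/-!
# `BalabanUV.Beta.GAN24.StaircaseFaceDensity` — binder row G-an2-4 / (CONV-C), CT-ROUTE, the row owner's `gen20/BORNSEC-PLAN-v1.md` v1.1 §A (Λ-C)(C5) «[S]»:
# **THE DENSITY OF THE SCALE-`s` FACES AMONG THE COARSE BONDS IS `Lc^{−s}`; AGAINST GEOMETRIC FACE LETTERS THE STAIRCASE OF FACES COSTS ONE `log`, AND THE
# `log`s ARE SWALLOWED BY ANY SLOWER GEOMETRIC RATE** — plan §0 (c) «`Σ_{s≤k−i} [N′^D·Lc^{−s}]·…·[Lc^s·…] = (k−i)·…`» and «`Σ_m m·Lc^{−m} < ∞`»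

NOT IN PRINT; OUR BOOKKEEPING (G-an2-4 formalisation swarm → CRUX TEAM (2), leaf prover `b2b-balaban-gan24-formalise-leaf-03`, gen 54; INTENT «FACE-DENSITY (C5)»
journal `CLAIMS.log` l.33773; names PROVISIONAL — the owner may rename ∕ re-cut).  [folklore] counting on `ℤ^{d+1}` and two geometric-series facts over the OWNER's
`StaircaseFaces.tsum_ite_dvd_eq` (F2) ∕ `quo_zsmul_add_toSite_of_dvd` (§5) and Mathlib (`Nat.card_multiples`, `tsum_choose_mul_geometric_of_norm_lt_one`,
`Nat.pow_sub_le_descFactorial`) BY NAME; 0 `def`, 0 cited facts, 0 `def … : Prop`, 0 sorry.  HONEST FRAMING (cell contract, verbatim): «discharging `BetaPertH`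
makes Bałaban's UV stability UNCONDITIONAL — a real constructive-QFT result; it is NOT the continuum limit and NOT the Clay problem.»  HONEST DEPENDENCY (verbatim):
«continuum YM on T⁴ ⇐ BetaPertH ∧ nine spine estimates (0/9 proved); BetaPertH ⇐ (D1) ∧ (D4) ∧ CAP+tail; G-an2-4 gates asym, D1 and NE2/3/4.»

## What (generic `d`; the face letter is leaf-01 g60's `ContactFaceJumpStaircase.sum_abs_jump_le` currency `Σ_{s<n} (if (Lc:ℤ)^s ∣ y κ + 1 then 2·a (s+1) else 0)` VERBATIM)
* §1 THE FACE FRACTION AT EVERY DIVIDING SCALE OF A BLOCK-SCALE WEIGHT: for `P ∣ M`, `1 ≤ P` and a summable block-scale weight `y ↦ g (quo M y)` (the tent ∕ leg envelopes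
  `e^{−κ₀‖quo N′ y − c‖∞}` of `RespStepDecay` ∕ `EnvelopeBlockSum` are of this form) **`tsum_ite_dvd_comp_quo_eq`**: `Σ'_y (if (P:ℤ) ∣ y κ + 1 then g (quo M y) else 0)
  = (P:ℝ)⁻¹·Σ'_y g (quo M y)` — the owner's (F2) with its block-constancy hypothesis discharged by his §5; and the owner's literal finite count **`card_box_filter_dvd`**:
  `#{r ∈ box (d+1) N : P ∣ r κ + 1} = N^d·(N ∕ P)` (`= N^{d+1}·P⁻¹` when `P ∣ N`: «`#{(μ,y) in range : s(y,μ) ≥ s} ≤ C·N′^D·Lc^{−s}`»).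
* §2 THE STAIRCASE OF FACES: scales `P s ∣ M`, `1 ≤ P s` (`s ∈ S` finite), letters `a s` — **`tsum_comp_quo_mul_sum_ite_dvd_eq`** (EXACT):
  `Σ'_y g (quo M y)·(Σ_{s∈S} if (P s:ℤ) ∣ y κ + 1 then a s else 0) = (Σ_{s∈S} a s·(P s)⁻¹)·Σ'_y g (quo M y)`, and the dominated form **`tsum_sum_ite_dvd_mul_abs_le`** for any
  `|w y| ≤ g (quo M y)`, `0 ≤ a s`.
* §3 GEOMETRIC LETTERS ⇒ ONE `log`, NOTHING MORE: `P s = Lc^s`, `S = range n`, `Lc^s ∣ M` (`s < n`), `0 ≤ a (s+1) ≤ α·Lc^{s+1}` ⇒ **`tsum_faceLetter_mul_abs_le`**: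
  `Σ'_y (Σ_{s<n} if (Lc:ℤ)^s ∣ y κ + 1 then 2·a (s+1) else 0)·|w y| ≤ 2·α·Lc·n·Σ'_y g (quo M y)` — the `(k−i)` of plan §0 (c), against the crude `Σ_{s<n} 2·a (s+1) ≈ 2α·Lc^{n+1}`.
* §4 ABSORBING THE `log`s INTO THE RATE (the letters by which `BornLambdaLetters.exists_hBLam_of_geometric_three`'s SINGLE `θ < 1` swallows `(k−i)`, `(k−i)²`; refuter
  SOCKET CHECK #73 «any θ′ ∈ (Lc⁻¹, 1)»): **`succ_pow_mul_pow_le`** `0 ≤ r < 1 ⇒ (m+1)^p·r^m ≤ p!·(1−r)^{−(p+1)}` (every `p`; `(m+1)^p ≤ p!·C(m+p,p)` and ONE term of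
  `Σ_n C(n+p,p) r^n = (1−r)^{−(p+1)}`), the two-rate form **`succ_pow_mul_pow_le_mul_pow`** `0 ≤ θ < θ′ ⇒ (m+1)^p·θ^m ≤ (p!·(1−θ∕θ′)^{−(p+1)})·θ′^m`, and the lineage sums
  UNIFORMLY IN THE DEPTH: **`sum_range_succ_pow_mul_pow_le`** `Σ_{m<K} (m+1)^p·r^{m+1} ≤ p!·r·(1−r)^{−(p+1)}` and its `i < k` spelling **`sum_range_sub_pow_mul_pow_le`**
  `Σ_{i<k} (k−i)^p·r^{k−i} ≤ p!·r·(1−r)^{−(p+1)}`.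
* §5 THE ABSTRACT (C4) COUNT **`tsum_abs_mul_le_of_faceLetter`**: a tent factor `|b y| ≤ T·g (quo M y)` times a commutator factor bounded by leaf-01's LOCALISED face letter
  `(W₀ + Σ_{s<n} [Lc^s ∣ y_κ+1]·2·a (s+1))·K` is summable with `Σ'_y |b y·c y| ≤ T·K·(W₀ + 2·α·Lc·n)·Σ'_y g (quo M y)` — the OWNER's W3 display «`Σ_{(μ,y)} |tent|·|[𝒬^ρ, λ̄] rE|`»
  with every analytic input a letter (the letters themselves are (C2) = the owner's tent modules and (C3) = leaf-01's `ContactFaceJump*`; NOT here).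
* §5 v2.1 (append-only) **`tsum_abs_mul_le_of_faceLetter'`**: the same count with a SITE-DEPENDENT leg∕envelope letter `K y ≥ 0` (`|b y|·K y ≤ P·g (quo M y)`,
  `|c y| ≤ (W₀ + F(y))·K y` ⇒ `Σ'_y |b·c| ≤ P·(W₀ + 2·α·Lc·n)·Σ' g∘quo M`) — the shape leaf-02 g49's (C4) PART 1 `ContactLambdaCellBound` §1 asked for (journal l.34465).
USE ((C4) ∕ (C6), owner ∕ crux team): (C4)'s cell sum `Σ_{(μ,y)} |tent(μ,y)|·F(μ,y)·|leg|` with leaf-01's face letter `F` and block-scale envelopes is §2 ∕ §3 BY NAME ⇒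
`(k−i)·Lc^{−(k−i)}` per birth level `i`; §4 turns `(k−i)^a·Lc^{−(k−i)}` into `C_a·θ′^{k−i}` for the socket, or sums it over the births uniformly in `k`.
Discharges NO slot letter and NO cell of (Λ-C); NO estimate of Bałaban's; 0 wall binders; hB ∕ hS0-comb OPEN (owner's (C6)); NEVER «G-an2-4 closed» as (CONV-C);
NOT hS0, NOT D1, NOT BetaPertH, NOT continuum, NOT Clay.
-/

noncomputable section

open Finset
open scoped BigOperators
open Literature.MathematicalPhysics.QuantumFieldTheory
open Literature.MathematicalPhysics.QuantumFieldTheory.LatticeForm (quo)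
open Literature.MathematicalPhysics.QuantumFieldTheory.Balaban1983to89
open Literature.MathematicalPhysics.QuantumFieldTheory.Balaban1983to89.Beta
open AffineAveraging (Site box toSite)
open Summit.QuantumFields.BalabanUV.Beta.GAN24.StaircaseFaces (tsum_ite_dvd_eq quo_zsmul_add_toSite_of_dvd)

namespace Summit.QuantumFields.BalabanUV.Beta.GAN24.StaircaseFaceDensity

variable {d : ℕ}

/-! ## §1 The face fraction at every dividing scale of a block-scale weight; the literal finite count -/

/-- [folklore] **(F2) AT EVERY DIVIDING SCALE, FOR A BLOCK-SCALE WEIGHT**: if `P ∣ M` (`1 ≤ P`) and `y ↦ g (quo M y)` is summable, the `κ`-faces of scale `P`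
carry exactly the fraction `P⁻¹` of its mass: `Σ'_y (if P ∣ y_κ + 1 then g (quo M y) else 0) = P⁻¹·Σ'_y g (quo M y)` (the owner's `tsum_ite_dvd_eq`; a function of
the `M`-block label is constant on the `P`-blocks by his `quo_zsmul_add_toSite_of_dvd`). -/
theorem tsum_ite_dvd_comp_quo_eq {P M : ℕ} (hP : 1 ≤ P) (hPM : P ∣ M) (g : Site (d + 1) → ℝ)
    (hg : Summable fun y : Site (d + 1) => g (quo M y)) (κ : Fin (d + 1)) :
    ∑' y : Site (d + 1), (if (P : ℤ) ∣ y κ + 1 then g (quo M y) else 0) = ((P : ℝ))⁻¹ * ∑' y : Site (d + 1), g (quo M y) :=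
  tsum_ite_dvd_eq hP hg (fun w _ hr => congrArg g (quo_zsmul_add_toSite_of_dvd hP hPM w hr)) κ

/-- [folklore] **THE LITERAL COUNT** (plan v1 §A (C5) «`#{(μ,y) in range : s(y,μ) ≥ s} ≤ C·N′^D·Lc^{−s}`», as an equality): among the `N^{d+1}` sites of the box of
side `N`, those whose `κ`-coordinate lies on a `P`-face (`P ∣ r_κ + 1`) number exactly `N^d·(N ∕ P)` (Mathlib's `Nat.card_multiples` on the `κ`-fibres). -/
theorem card_box_filter_dvd (N P : ℕ) (κ : Fin (d + 1)) :
    ((box (d + 1) N).filter (fun r => P ∣ r κ + 1)).card = N ^ d * (N / P) := by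
  classical
  set s := (box (d + 1) N).filter (fun r => P ∣ r κ + 1) with hs
  set t := (Finset.range N).filter (fun e => P ∣ e + 1) with ht
  have hmap : ∀ r ∈ s, r κ ∈ t := by
    intro r hr
    rw [hs, Finset.mem_filter] at hr
    rw [ht, Finset.mem_filter]
    exact ⟨Fintype.mem_piFinset.1 hr.1 κ, hr.2⟩
  rw [Finset.card_eq_sum_card_fiberwise hmap]
  have hfib : ∀ e ∈ t, (s.filter (fun r => r κ = e)).card = N ^ d := by
    intro e he
    rw [ht, Finset.mem_filter] at he
    have e1 : s.filter (fun r => r κ = e) = (box (d + 1) N).filter (fun r => r κ = e) := by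
      ext r
      simp only [hs, Finset.mem_filter]
      constructor
      · rintro ⟨⟨hb, -⟩, hre⟩; exact ⟨hb, hre⟩
      · rintro ⟨hb, hre⟩; exact ⟨⟨hb, by rw [hre]; exact he.2⟩, hre⟩
    rw [e1]
    have h := Fintype.card_filter_piFinset_const_eq_of_mem (ι := Fin (d + 1)) (Finset.range N) κ he.1
    rw [Finset.card_range, Fintype.card_fin, Nat.add_sub_cancel] at h
    exact h
  rw [Finset.sum_congr rfl hfib, Finset.sum_const, smul_eq_mul, ht, Nat.card_multiples, mul_comm]

/-! ## §2 The staircase of faces: a finite family of dividing scales with letters -/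

/-- [folklore] Each scale's weighted indicator is summable (dominated by `|a|·|g ∘ quo M|`). -/
theorem summable_comp_quo_mul_ite {M : ℕ} {g : Site (d + 1) → ℝ} (hg : Summable fun y : Site (d + 1) => g (quo M y)) (Q : ℤ) (a : ℝ)
    (κ : Fin (d + 1)) : Summable fun y : Site (d + 1) => g (quo M y) * (if Q ∣ y κ + 1 then a else 0) := by
  refine Summable.of_norm_bounded (hg.norm.mul_right |a|) (fun y => ?_)
  rw [Real.norm_eq_abs, Real.norm_eq_abs, abs_mul]
  refine mul_le_mul_of_nonneg_left ?_ (abs_nonneg _)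
  split_ifs
  · exact le_rfl
  · rw [abs_zero]; exact abs_nonneg a

/-- [folklore] **THE STAIRCASE OF FACES** (EXACT): for finitely many scales `P s ∣ M`, `1 ≤ P s` (`s ∈ S`) with letters `a s` and a summable block-scale weight,
`Σ'_y g (quo M y)·(Σ_{s∈S} if P s ∣ y_κ + 1 then a s else 0) = (Σ_{s∈S} a s·(P s)⁻¹)·Σ'_y g (quo M y)` — the scale-`s` faces contribute their letter with density `(P s)⁻¹`. -/
theorem tsum_comp_quo_mul_sum_ite_dvd_eq {M : ℕ} (g : Site (d + 1) → ℝ) (hg : Summable fun y : Site (d + 1) => g (quo M y))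
    (S : Finset ℕ) (P : ℕ → ℕ) (hP : ∀ s ∈ S, 1 ≤ P s ∧ P s ∣ M) (a : ℕ → ℝ) (κ : Fin (d + 1)) :
    ∑' y : Site (d + 1), g (quo M y) * (∑ s ∈ S, if ((P s : ℕ) : ℤ) ∣ y κ + 1 then a s else 0)
      = (∑ s ∈ S, a s * ((P s : ℝ))⁻¹) * ∑' y : Site (d + 1), g (quo M y) := by
  have hsum : ∀ s ∈ S, Summable fun y : Site (d + 1) => g (quo M y) * (if ((P s : ℕ) : ℤ) ∣ y κ + 1 then a s else 0) :=
    fun s _ => summable_comp_quo_mul_ite hg _ (a s) κ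
  calc ∑' y : Site (d + 1), g (quo M y) * (∑ s ∈ S, if ((P s : ℕ) : ℤ) ∣ y κ + 1 then a s else 0)
      = ∑' y : Site (d + 1), ∑ s ∈ S, g (quo M y) * (if ((P s : ℕ) : ℤ) ∣ y κ + 1 then a s else 0) := by
        simp_rw [Finset.mul_sum]
    _ = ∑ s ∈ S, ∑' y : Site (d + 1), g (quo M y) * (if ((P s : ℕ) : ℤ) ∣ y κ + 1 then a s else 0) := Summable.tsum_finsetSum hsum
    _ = ∑ s ∈ S, a s * ((P s : ℝ))⁻¹ * ∑' y : Site (d + 1), g (quo M y) := by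
        refine Finset.sum_congr rfl fun s hs => ?_
        have e : (fun y : Site (d + 1) => g (quo M y) * (if ((P s : ℕ) : ℤ) ∣ y κ + 1 then a s else 0))
            = fun y => if ((P s : ℕ) : ℤ) ∣ y κ + 1 then (fun q => a s * g q) (quo M y) else 0 := by
          funext y; split_ifs <;> ring
        rw [e, tsum_ite_dvd_comp_quo_eq (hP s hs).1 (hP s hs).2 (fun q => a s * g q) (hg.mul_left (a s)) κ, tsum_mul_left]
        ring
    _ = (∑ s ∈ S, a s * ((P s : ℝ))⁻¹) * ∑' y : Site (d + 1), g (quo M y) := by rw [Finset.sum_mul]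

/-- [folklore] **THE DOMINATED FORM**: for any weight `|w y| ≤ g (quo M y)` under a summable block-scale envelope and letters `a s ≥ 0` on dividing scales,
`Σ'_y (Σ_{s∈S} if P s ∣ y_κ + 1 then a s else 0)·|w y| ≤ (Σ_{s∈S} a s·(P s)⁻¹)·Σ'_y g (quo M y)`. -/
theorem tsum_sum_ite_dvd_mul_abs_le {M : ℕ} {g w : Site (d + 1) → ℝ} (hg : Summable fun y : Site (d + 1) => g (quo M y))
    (hw : ∀ y, |w y| ≤ g (quo M y)) (S : Finset ℕ) (P : ℕ → ℕ) (hP : ∀ s ∈ S, 1 ≤ P s ∧ P s ∣ M) {a : ℕ → ℝ} (ha : ∀ s ∈ S, 0 ≤ a s)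
    (κ : Fin (d + 1)) :
    ∑' y : Site (d + 1), (∑ s ∈ S, if ((P s : ℕ) : ℤ) ∣ y κ + 1 then a s else 0) * |w y|
      ≤ (∑ s ∈ S, a s * ((P s : ℝ))⁻¹) * ∑' y : Site (d + 1), g (quo M y) := by
  have hF : ∀ y : Site (d + 1), 0 ≤ ∑ s ∈ S, (if ((P s : ℕ) : ℤ) ∣ y κ + 1 then a s else 0) := fun y =>
    Finset.sum_nonneg fun s hs => by split_ifs; exacts [ha s hs, le_rfl]
  have hle : ∀ y : Site (d + 1), (∑ s ∈ S, if ((P s : ℕ) : ℤ) ∣ y κ + 1 then a s else 0) * |w y|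
      ≤ g (quo M y) * (∑ s ∈ S, if ((P s : ℕ) : ℤ) ∣ y κ + 1 then a s else 0) := fun y => by
    rw [mul_comm (g (quo M y))]
    exact mul_le_mul_of_nonneg_left (hw y) (hF y)
  have hR : Summable fun y : Site (d + 1) => g (quo M y) * (∑ s ∈ S, if ((P s : ℕ) : ℤ) ∣ y κ + 1 then a s else 0) := by
    have h := summable_sum (s := S) fun s (_ : s ∈ S) => summable_comp_quo_mul_ite hg (((P s : ℕ) : ℤ)) (a s) κ
    refine h.congr fun y => ?_
    rw [Finset.mul_sum]
  have hL : Summable fun y : Site (d + 1) => (∑ s ∈ S, if ((P s : ℕ) : ℤ) ∣ y κ + 1 then a s else 0) * |w y| :=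
    Summable.of_nonneg_of_le (fun y => mul_nonneg (hF y) (abs_nonneg _)) hle hR
  calc ∑' y : Site (d + 1), (∑ s ∈ S, if ((P s : ℕ) : ℤ) ∣ y κ + 1 then a s else 0) * |w y|
      ≤ ∑' y : Site (d + 1), g (quo M y) * (∑ s ∈ S, if ((P s : ℕ) : ℤ) ∣ y κ + 1 then a s else 0) := hL.tsum_le_tsum hle hR
    _ = (∑ s ∈ S, a s * ((P s : ℝ))⁻¹) * ∑' y : Site (d + 1), g (quo M y) := tsum_comp_quo_mul_sum_ite_dvd_eq g hg S P hP a κ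

/-! ## §3 Geometric letters on the tower `Lc^s`: one `log`, nothing more -/

/-- [folklore] **THE STAIRCASE OF FACES AGAINST GEOMETRIC LETTERS COSTS ONE `log`** (leaf-01's face-letter currency): for `1 ≤ Lc`, `Lc^s ∣ M` (`s < n`), a summable
block-scale envelope `g ∘ quo M` dominating `|w|`, and letters `0 ≤ a (s+1) ≤ α·Lc^{s+1}`,
`Σ'_y (Σ_{s<n} if (Lc:ℤ)^s ∣ y_κ + 1 then 2·a (s+1) else 0)·|w y| ≤ 2·α·Lc·n·Σ'_y g (quo M y)` — each crossed scale contributes `2·a(s+1)·Lc^{−s} ≤ 2α·Lc`. -/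
theorem tsum_faceLetter_mul_abs_le {Lc M n : ℕ} (hLc : 1 ≤ Lc) (hM : ∀ s, s < n → Lc ^ s ∣ M) {g w : Site (d + 1) → ℝ}
    (hg : Summable fun y : Site (d + 1) => g (quo M y)) (hw : ∀ y, |w y| ≤ g (quo M y)) {a : ℕ → ℝ} {α : ℝ}
    (ha : ∀ s, s < n → 0 ≤ a (s + 1) ∧ a (s + 1) ≤ α * (Lc : ℝ) ^ (s + 1)) (κ : Fin (d + 1)) :
    ∑' y : Site (d + 1), (∑ s ∈ Finset.range n, if (Lc : ℤ) ^ s ∣ y κ + 1 then 2 * a (s + 1) else 0) * |w y|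
      ≤ 2 * α * Lc * n * ∑' y : Site (d + 1), g (quo M y) := by
  have hL0 : (0 : ℝ) < Lc := by exact_mod_cast hLc
  have hP : ∀ s ∈ Finset.range n, 1 ≤ Lc ^ s ∧ Lc ^ s ∣ M := fun s hs =>
    ⟨Nat.one_le_pow _ _ hLc, hM s (Finset.mem_range.1 hs)⟩
  have h := tsum_sum_ite_dvd_mul_abs_le hg hw (Finset.range n) (fun s => Lc ^ s) hP (a := fun s => 2 * a (s + 1))
    (fun s hs => by have := (ha s (Finset.mem_range.1 hs)).1; positivity) κ
  simp only [Nat.cast_pow] at h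
  refine h.trans ?_
  -- the mass is nonnegative and each crossed scale costs at most `2α·Lc`
  have hmass : 0 ≤ ∑' y : Site (d + 1), g (quo M y) := tsum_nonneg fun y => (abs_nonneg _).trans (hw y)
  have hterm : ∀ s ∈ Finset.range n, 2 * a (s + 1) * ((Lc : ℝ) ^ s)⁻¹ ≤ 2 * α * Lc := by
    intro s hs
    have hs' := ha s (Finset.mem_range.1 hs)
    have hpow : (0 : ℝ) < (Lc : ℝ) ^ s := pow_pos hL0 s
    rw [mul_assoc, ← div_eq_mul_inv, mul_assoc]
    refine mul_le_mul_of_nonneg_left ?_ (by norm_num)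
    rw [div_le_iff₀ hpow]
    calc a (s + 1) ≤ α * (Lc : ℝ) ^ (s + 1) := hs'.2
      _ = α * Lc * (Lc : ℝ) ^ s := by ring
  calc (∑ s ∈ Finset.range n, 2 * a (s + 1) * ((Lc : ℝ) ^ s)⁻¹) * ∑' y : Site (d + 1), g (quo M y)
      ≤ (∑ _s ∈ Finset.range n, 2 * α * Lc) * ∑' y : Site (d + 1), g (quo M y) :=
        mul_le_mul_of_nonneg_right (Finset.sum_le_sum hterm) hmass
    _ = 2 * α * Lc * n * ∑' y : Site (d + 1), g (quo M y) := by
        rw [Finset.sum_const, Finset.card_range, nsmul_eq_mul]; ring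

/-! ## §4 Absorbing the `log`s into the rate -/

/-- [folklore] **`(m+1)^p·r^m ≤ p!·(1−r)^{−(p+1)}`** (`0 ≤ r < 1`, every `p m`): `(m+1)^p ≤ (m+p)!∕m! = p!·C(m+p,p)` (`Nat.pow_sub_le_descFactorial`) and
`C(m+p,p)·r^m` is ONE term of `Σ_n C(n+p,p)·r^n = (1−r)^{−(p+1)}` (`tsum_choose_mul_geometric_of_norm_lt_one`). -/
theorem succ_pow_mul_pow_le {r : ℝ} (hr0 : 0 ≤ r) (hr1 : r < 1) (p m : ℕ) :
    ((m : ℝ) + 1) ^ p * r ^ m ≤ (p.factorial : ℝ) / (1 - r) ^ (p + 1) := by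
  have hnorm : ‖r‖ < 1 := by rw [Real.norm_eq_abs, abs_of_nonneg hr0]; exact hr1
  have hs := summable_choose_mul_geometric_of_norm_lt_one p hnorm
  have ht := tsum_choose_mul_geometric_of_norm_lt_one p hnorm
  have h1 : ((m : ℝ) + 1) ^ p ≤ (p.factorial : ℝ) * (((m + p).choose p : ℕ) : ℝ) := by
    have h := Nat.pow_sub_le_descFactorial (m + p) p
    rw [show m + p + 1 - p = m + 1 by omega, Nat.descFactorial_eq_factorial_mul_choose] at h
    exact_mod_cast h
  have h2 : (((m + p).choose p : ℕ) : ℝ) * r ^ m ≤ ∑' n : ℕ, (((n + p).choose p : ℕ) : ℝ) * r ^ n :=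
    hs.le_tsum m (fun j _ => by positivity)
  calc ((m : ℝ) + 1) ^ p * r ^ m ≤ (p.factorial : ℝ) * ((((m + p).choose p : ℕ) : ℝ) * r ^ m) := by
        rw [← mul_assoc]; exact mul_le_mul_of_nonneg_right h1 (pow_nonneg hr0 m)
    _ ≤ (p.factorial : ℝ) * ∑' n : ℕ, (((n + p).choose p : ℕ) : ℝ) * r ^ n := mul_le_mul_of_nonneg_left h2 (by positivity)
    _ = (p.factorial : ℝ) / (1 - r) ^ (p + 1) := by rw [ht]; ring

/-- [folklore] **THE TWO-RATE FORM**: for `0 ≤ θ < θ′` and every `p m`, `(m+1)^p·θ^m ≤ (p!·(1 − θ∕θ′)^{−(p+1)})·θ′^m` — the polynomial prefactor is absorbed by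
any slower geometric rate (e.g. `θ = Lc⁻¹`, any `θ′ ∈ (Lc⁻¹, 1)` for `exists_hBLam_of_geometric_three`). -/
theorem succ_pow_mul_pow_le_mul_pow {θ θ' : ℝ} (hθ : 0 ≤ θ) (hθ' : θ < θ') (p m : ℕ) :
    ((m : ℝ) + 1) ^ p * θ ^ m ≤ ((p.factorial : ℝ) / (1 - θ / θ') ^ (p + 1)) * θ' ^ m := by
  have hθ'0 : 0 < θ' := lt_of_le_of_lt hθ hθ'
  have hr0 : 0 ≤ θ / θ' := div_nonneg hθ hθ'0.le
  have hr1 : θ / θ' < 1 := (div_lt_one hθ'0).2 hθ'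
  have h := succ_pow_mul_pow_le hr0 hr1 p m
  have e : θ ^ m = (θ / θ') ^ m * θ' ^ m := by
    rw [← mul_pow, div_mul_cancel₀ θ hθ'0.ne']
  rw [e, ← mul_assoc]
  exact mul_le_mul_of_nonneg_right h (pow_nonneg hθ'0.le m)

/-- [folklore] **THE LINEAGE SUMS, UNIFORMLY IN THE DEPTH**: `Σ_{m<K} (m+1)^p·r^{m+1} ≤ p!·r·(1−r)^{−(p+1)}` (`0 ≤ r < 1`; every `K`). -/
theorem sum_range_succ_pow_mul_pow_le {r : ℝ} (hr0 : 0 ≤ r) (hr1 : r < 1) (p K : ℕ) :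
    ∑ m ∈ Finset.range K, ((m : ℝ) + 1) ^ p * r ^ (m + 1) ≤ (p.factorial : ℝ) * r / (1 - r) ^ (p + 1) := by
  have hnorm : ‖r‖ < 1 := by rw [Real.norm_eq_abs, abs_of_nonneg hr0]; exact hr1
  have hs := summable_choose_mul_geometric_of_norm_lt_one p hnorm
  have ht := tsum_choose_mul_geometric_of_norm_lt_one p hnorm
  have h1 : ∀ m : ℕ, ((m : ℝ) + 1) ^ p ≤ (p.factorial : ℝ) * (((m + p).choose p : ℕ) : ℝ) := by
    intro m
    have h := Nat.pow_sub_le_descFactorial (m + p) p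
    rw [show m + p + 1 - p = m + 1 by omega, Nat.descFactorial_eq_factorial_mul_choose] at h
    exact_mod_cast h
  have hstep : ∀ m ∈ Finset.range K, ((m : ℝ) + 1) ^ p * r ^ (m + 1)
      ≤ ((p.factorial : ℝ) * r) * ((((m + p).choose p : ℕ) : ℝ) * r ^ m) := by
    intro m _
    rw [pow_succ]
    calc ((m : ℝ) + 1) ^ p * (r ^ m * r) = (((m : ℝ) + 1) ^ p) * r ^ m * r := by ring
      _ ≤ ((p.factorial : ℝ) * (((m + p).choose p : ℕ) : ℝ)) * r ^ m * r :=
          mul_le_mul_of_nonneg_right (mul_le_mul_of_nonneg_right (h1 m) (pow_nonneg hr0 m)) hr0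
      _ = ((p.factorial : ℝ) * r) * ((((m + p).choose p : ℕ) : ℝ) * r ^ m) := by ring
  have hpart : ∑ m ∈ Finset.range K, (((m + p).choose p : ℕ) : ℝ) * r ^ m ≤ ∑' n : ℕ, (((n + p).choose p : ℕ) : ℝ) * r ^ n :=
    hs.sum_le_tsum (Finset.range K) (fun n _ => by positivity)
  calc ∑ m ∈ Finset.range K, ((m : ℝ) + 1) ^ p * r ^ (m + 1)
      ≤ ∑ m ∈ Finset.range K, ((p.factorial : ℝ) * r) * ((((m + p).choose p : ℕ) : ℝ) * r ^ m) := Finset.sum_le_sum hstep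
    _ = ((p.factorial : ℝ) * r) * ∑ m ∈ Finset.range K, (((m + p).choose p : ℕ) : ℝ) * r ^ m := by rw [Finset.mul_sum]
    _ ≤ ((p.factorial : ℝ) * r) * ∑' n : ℕ, (((n + p).choose p : ℕ) : ℝ) * r ^ n := mul_le_mul_of_nonneg_left hpart (by positivity)
    _ = (p.factorial : ℝ) * r / (1 - r) ^ (p + 1) := by rw [ht]; ring

/-- [folklore] **THE SAME IN THE BIRTH-LEVEL SPELLING**: `Σ_{i<k} (k−i)^p·r^{k−i} ≤ p!·r·(1−r)^{−(p+1)}` (`0 ≤ r < 1`; every `k`) — the plan's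
«`Σ_{i<k}(k−i)^2 Lc^{−(k−i)}` summable over the birth levels uniformly in `k`» at `r = Lc⁻¹`, `p = 2`. -/
theorem sum_range_sub_pow_mul_pow_le {r : ℝ} (hr0 : 0 ≤ r) (hr1 : r < 1) (p k : ℕ) :
    ∑ i ∈ Finset.range k, (((k - i : ℕ) : ℝ)) ^ p * r ^ (k - i) ≤ (p.factorial : ℝ) * r / (1 - r) ^ (p + 1) := by
  have e : ∑ i ∈ Finset.range k, (((k - i : ℕ) : ℝ)) ^ p * r ^ (k - i) = ∑ m ∈ Finset.range k, ((m : ℝ) + 1) ^ p * r ^ (m + 1) := by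
    rw [← Finset.sum_range_reflect (fun m => ((m : ℝ) + 1) ^ p * r ^ (m + 1)) k]
    refine Finset.sum_congr rfl fun i hi => ?_
    have hik : i < k := Finset.mem_range.1 hi
    have e1 : k - i = (k - 1 - i) + 1 := by omega
    rw [e1]; push_cast; ring_nf
  rw [e]
  exact sum_range_succ_pow_mul_pow_le hr0 hr1 p k


/-! ## §5 The abstract cell count of plan §0 (c): (tent letter) × (localised commutator letter), summed over the coarse sites -/

/-- [folklore] **THE ABSTRACT (C4) COUNT** — the shape of BORNSEC-PLAN v1.1 §0 (c) ∕ the OWNER's W3 display «`Σ_{(μ,y)} |tent(μ,y)|·|[𝒬^ρ, λ̄] rE (μ,y)|`» with every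
analytic input a LETTER: a TENT factor `|b y| ≤ T·g (quo M y)` under a summable nonnegative block-scale envelope, and a COMMUTATOR factor bounded by the localised face letter of
leaf-01 g60's PART 2∕3 `|c y| ≤ (W₀ + Σ_{s<n} [Lc^s ∣ y_κ+1]·2·a (s+1))·K` (`W₀` = the finest-piece weight, `K` = the leg ∕ count letter), geometric letters `0 ≤ a (s+1) ≤ α·Lc^{s+1}` on
dividing scales `Lc^s ∣ M` (`s < n`).  THEN the product is summable and
`Σ'_y |b y·c y| ≤ T·K·(W₀ + 2·α·Lc·n)·Σ'_y g (quo M y)` — ONE factor `n` (the `(k−i)` of the plan), never `Lc^n`. -/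
theorem tsum_abs_mul_le_of_faceLetter {Lc M n : ℕ} (hLc : 1 ≤ Lc) (hM : ∀ s, s < n → Lc ^ s ∣ M) {g : Site (d + 1) → ℝ}
    (hg : Summable fun y : Site (d + 1) => g (quo M y)) (hg0 : ∀ y : Site (d + 1), 0 ≤ g (quo M y)) {a : ℕ → ℝ} {α : ℝ}
    (ha : ∀ s, s < n → 0 ≤ a (s + 1) ∧ a (s + 1) ≤ α * (Lc : ℝ) ^ (s + 1)) (κ : Fin (d + 1)) {b c : Site (d + 1) → ℝ} {T K W₀ : ℝ}
    (hT : 0 ≤ T) (hK : 0 ≤ K) (hb : ∀ y, |b y| ≤ T * g (quo M y))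
    (hc : ∀ y, |c y| ≤ (W₀ + ∑ s ∈ Finset.range n, (if (Lc : ℤ) ^ s ∣ y κ + 1 then 2 * a (s + 1) else 0)) * K) :
    (Summable fun y : Site (d + 1) => b y * c y) ∧
      ∑' y : Site (d + 1), |b y * c y| ≤ T * K * (W₀ + 2 * α * Lc * n) * ∑' y : Site (d + 1), g (quo M y) := by
  -- the face letter and its pointwise nonnegativity
  set F : Site (d + 1) → ℝ := fun y => ∑ s ∈ Finset.range n, (if (Lc : ℤ) ^ s ∣ y κ + 1 then 2 * a (s + 1) else 0) with hF
  have hF0 : ∀ y, 0 ≤ F y := fun y => Finset.sum_nonneg fun s hs => by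
    split_ifs
    · have := (ha s (Finset.mem_range.1 hs)).1; positivity
    · exact le_rfl
  -- pointwise domination by `T·K·(W₀·g + F·g)`
  have hdom : ∀ y, |b y * c y| ≤ T * K * (W₀ * g (quo M y) + F y * |g (quo M y)|) := by
    intro y
    rw [abs_mul, abs_of_nonneg (hg0 y)]
    calc |b y| * |c y| ≤ (T * g (quo M y)) * ((W₀ + F y) * K) :=
          mul_le_mul (hb y) (hc y) (abs_nonneg _) (mul_nonneg hT (hg0 y))
      _ = T * K * (W₀ * g (quo M y) + F y * g (quo M y)) := by ring
  -- the dominating family is summable: `W₀·g` and the face-letter part (finite sum of dominated indicators)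
  have hFg : Summable fun y : Site (d + 1) => F y * |g (quo M y)| := by
    have h := summable_sum (s := Finset.range n) fun s (_ : s ∈ Finset.range n) =>
      summable_comp_quo_mul_ite hg ((Lc : ℤ) ^ s) (2 * a (s + 1)) κ
    refine (Summable.of_nonneg_of_le (fun y => mul_nonneg (hF0 y) (abs_nonneg _)) (fun y => ?_) h)
    rw [abs_of_nonneg (hg0 y), hF, Finset.sum_mul]
    refine le_of_eq (Finset.sum_congr rfl fun s _ => ?_)
    ring
  have hR : Summable fun y : Site (d + 1) => T * K * (W₀ * g (quo M y) + F y * |g (quo M y)|) :=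
    ((hg.mul_left W₀).add hFg).mul_left (T * K)
  have hS : Summable fun y : Site (d + 1) => b y * c y :=
    Summable.of_norm_bounded hR (fun y => by rw [Real.norm_eq_abs]; exact hdom y)
  refine ⟨hS, ?_⟩
  -- sum the domination and feed §3
  have h3 : ∑' y : Site (d + 1), F y * |g (quo M y)| ≤ 2 * α * Lc * n * ∑' y : Site (d + 1), g (quo M y) :=
    tsum_faceLetter_mul_abs_le hLc hM hg (fun y => by rw [abs_of_nonneg (hg0 y)]) ha κ
  have hmass : 0 ≤ ∑' y : Site (d + 1), g (quo M y) := tsum_nonneg hg0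
  calc ∑' y : Site (d + 1), |b y * c y| ≤ ∑' y : Site (d + 1), T * K * (W₀ * g (quo M y) + F y * |g (quo M y)|) :=
        hS.abs.tsum_le_tsum hdom hR
    _ = T * K * (W₀ * ∑' y : Site (d + 1), g (quo M y) + ∑' y : Site (d + 1), F y * |g (quo M y)|) := by
        rw [tsum_mul_left, ((hg.mul_left W₀).tsum_add hFg), tsum_mul_left]
    _ ≤ T * K * (W₀ * ∑' y : Site (d + 1), g (quo M y) + 2 * α * Lc * n * ∑' y : Site (d + 1), g (quo M y)) := by
        have hTK : 0 ≤ T * K := mul_nonneg hT hK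
        nlinarith [h3, hTK]
    _ = T * K * (W₀ + 2 * α * Lc * n) * ∑' y : Site (d + 1), g (quo M y) := by ring

/-- [folklore] **THE ABSTRACT (C4) COUNT WITH A SITE-DEPENDENT LEG LETTER** (v2.1, append-only — the shape leaf-02 g49's (C4) PART 1 `ContactLambdaCellBound` §1 asks for: the
`LocStencil` decay in the far arguments lives in the leg sup and in the gauge pieces' envelopes, so the leg∕envelope letter `K` must be allowed to depend on the coarse site):
with `0 ≤ K y`, `0 ≤ W₀`, a TENT×LEG letter `|b y|·K y ≤ P·g (quo M y)` under a summable block-scale envelope, and a COMMUTATOR factor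
`|c y| ≤ (W₀ + Σ_{s<n} [Lc^s ∣ y_κ+1]·2·a(s+1))·K y` with geometric letters `0 ≤ a(s+1) ≤ α·Lc^{s+1}` on dividing scales `Lc^s ∣ M` (`s < n`), the product is summable and
`Σ'_y |b y·c y| ≤ P·(W₀ + 2·α·Lc·n)·Σ'_y g (quo M y)`.  (`tsum_abs_mul_le_of_faceLetter` is the case `K` constant, `P = T·K`.) -/
theorem tsum_abs_mul_le_of_faceLetter' {Lc M n : ℕ} (hLc : 1 ≤ Lc) (hM : ∀ s, s < n → Lc ^ s ∣ M) {g : Site (d + 1) → ℝ}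
    (hg : Summable fun y : Site (d + 1) => g (quo M y)) {a : ℕ → ℝ} {α : ℝ}
    (ha : ∀ s, s < n → 0 ≤ a (s + 1) ∧ a (s + 1) ≤ α * (Lc : ℝ) ^ (s + 1)) (κ : Fin (d + 1)) {b c K : Site (d + 1) → ℝ} {P W₀ : ℝ}
    (hK : ∀ y, 0 ≤ K y) (hW : 0 ≤ W₀) (hb : ∀ y, |b y| * K y ≤ P * g (quo M y))
    (hc : ∀ y, |c y| ≤ (W₀ + ∑ s ∈ Finset.range n, (if (Lc : ℤ) ^ s ∣ y κ + 1 then 2 * a (s + 1) else 0)) * K y) :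
    (Summable fun y : Site (d + 1) => b y * c y) ∧
      ∑' y : Site (d + 1), |b y * c y| ≤ P * (W₀ + 2 * α * Lc * n) * ∑' y : Site (d + 1), g (quo M y) := by
  -- the face letter and its pointwise nonnegativity
  set F : Site (d + 1) → ℝ := fun y => ∑ s ∈ Finset.range n, (if (Lc : ℤ) ^ s ∣ y κ + 1 then 2 * a (s + 1) else 0) with hF
  have hF0 : ∀ y, 0 ≤ F y := fun y => Finset.sum_nonneg fun s hs => by
    split_ifs
    · have := (ha s (Finset.mem_range.1 hs)).1; positivity
    · exact le_rfl
  -- `P·g` dominates `|b|·K ≥ 0` pointwise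
  have hPg : ∀ y, 0 ≤ P * g (quo M y) := fun y => (mul_nonneg (abs_nonneg _) (hK y)).trans (hb y)
  -- pointwise domination by `(W₀ + F)·(P·g)`
  have hdom : ∀ y, |b y * c y| ≤ W₀ * (P * g (quo M y)) + F y * |P * g (quo M y)| := by
    intro y
    rw [abs_mul, abs_of_nonneg (hPg y)]
    calc |b y| * |c y| ≤ |b y| * ((W₀ + F y) * K y) := mul_le_mul_of_nonneg_left (hc y) (abs_nonneg _)
      _ = (W₀ + F y) * (|b y| * K y) := by ring
      _ ≤ (W₀ + F y) * (P * g (quo M y)) := mul_le_mul_of_nonneg_left (hb y) (add_nonneg hW (hF0 y))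
      _ = W₀ * (P * g (quo M y)) + F y * (P * g (quo M y)) := by ring
  -- the dominating family is summable
  have hgP : Summable fun y : Site (d + 1) => P * g (quo M y) := hg.mul_left P
  have hFg : Summable fun y : Site (d + 1) => F y * |P * g (quo M y)| := by
    have h := summable_sum (s := Finset.range n) fun s (_ : s ∈ Finset.range n) =>
      summable_comp_quo_mul_ite (M := M) (g := fun q => P * g q) hgP ((Lc : ℤ) ^ s) (2 * a (s + 1)) κ
    refine (Summable.of_nonneg_of_le (fun y => mul_nonneg (hF0 y) (abs_nonneg _)) (fun y => ?_) h)
    rw [abs_of_nonneg (hPg y), hF, Finset.sum_mul]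
    refine le_of_eq (Finset.sum_congr rfl fun s _ => ?_)
    ring
  have hR : Summable fun y : Site (d + 1) => W₀ * (P * g (quo M y)) + F y * |P * g (quo M y)| := (hgP.mul_left W₀).add hFg
  have hS : Summable fun y : Site (d + 1) => b y * c y :=
    Summable.of_norm_bounded hR (fun y => by rw [Real.norm_eq_abs]; exact hdom y)
  refine ⟨hS, ?_⟩
  -- sum the domination and feed §3 with the envelope `P·g`
  have h3 : ∑' y : Site (d + 1), F y * |P * g (quo M y)| ≤ 2 * α * Lc * n * ∑' y : Site (d + 1), P * g (quo M y) :=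
    tsum_faceLetter_mul_abs_le (M := M) (g := fun q => P * g q) (w := fun y => P * g (quo M y)) hLc hM hgP
      (fun y => by simp only [abs_of_nonneg (hPg y)]; exact le_rfl) ha κ
  have hmass : ∑' y : Site (d + 1), P * g (quo M y) = P * ∑' y : Site (d + 1), g (quo M y) := tsum_mul_left
  rw [hmass] at h3
  calc ∑' y : Site (d + 1), |b y * c y| ≤ ∑' y : Site (d + 1), (W₀ * (P * g (quo M y)) + F y * |P * g (quo M y)|) :=
        hS.abs.tsum_le_tsum hdom hR
    _ = W₀ * (P * ∑' y : Site (d + 1), g (quo M y)) + ∑' y : Site (d + 1), F y * |P * g (quo M y)| := by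
        rw [((hgP.mul_left W₀).tsum_add hFg), tsum_mul_left, tsum_mul_left]
    _ ≤ W₀ * (P * ∑' y : Site (d + 1), g (quo M y)) + 2 * α * Lc * n * (P * ∑' y : Site (d + 1), g (quo M y)) := by
        linarith [h3]
    _ = P * (W₀ + 2 * α * Lc * n) * ∑' y : Site (d + 1), g (quo M y) := by ring

end Summit.QuantumFields.BalabanUV.Beta.GAN24.StaircaseFaceDensity

end
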